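import Literature.Probability.Percolation.SeededExplorer
import HarnessLib

/-!
# The one-sided (dual flooding) seeded exploration: the lowest crossing of a general lattice domain

Topic `Literature/Probability/Percolation`; definitions-and-proofs support file (no named fact)
for the mesh-independent gluing Proposition 4.1 of O. Schramm, S. Smirnov, *On the scaling limits
of planar percolation*, Ann. Probab. 39 (2011), arXiv:1101.5820 — the engine of every "lowest
crossing" step of its proof (Lemma 6.1, p. 22: "let `γ` be the 'lowest' `ω`-crossing … The lowest
crossing `γ` depends only on the configuration inside `M̄`, so the restriction of `ω` to
`[Q] ∖ M` is unbiased"; used in §4 through (4.5) "by several applications of Lemma 6.1") in a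
form valid for ARBITRARY finite lattice domains of `ℤ²` (the fresh regions of Prop. 4.1 are not
rectangles): Kesten's / Bollobás–Riordan's conditioning on the lowest crossing ("condition on the
lowest black left-right crossing `c` … the percolation in the region above it remains unbiased",
Bollobás–Riordan 2006, Ch. 7 p. 175; the tree's `LowestCrossing.lean` (`dualBelow`) is the case of
a rectangle).

The lowest crossing is realised, as in `LowestCrossing.lean`, by FLOODING the dual from seed
faces: with seeds `𝔖 = (A, O₀, D₀)` (`SeededExplorer.lean`; `O₀` is not used), the explorer
`Seeded.flood 𝔖` examines, while there is one, an unexamined examinable edge having a face in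
`𝒟` (`Seeded.FloodEligible`; `𝒟` = faces joined to a seed face across examined closed edges).
At termination (`Seeded.IsFloodTerminal`, reached by time `termTime 𝔖`, `isFloodTerminal_flooded`):

* every examined closed edge has both faces in `𝒟`, and **every examinable edge with a face in
  `𝒟` is examined** (`IsFloodTerminal.mem_of_dReach`); hence
* **the frontier of `𝒟` consists of examined OPEN edges** (`IsFloodTerminal.mem_and_mem_of_isFrontier`:
  "the lowest crossing", together with the boundaries of the enclosed pockets), and
* `𝒟` is the whole dual cluster of the seed faces through closed examinable edges
  (`IsFloodTerminal.dReach_of_reflTransGen`: the flooding misses nothing);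
* the flooded (examined) set `Seeded.flooded 𝔖 ω` is a **stopping set** with values in `A`
  (`isStoppingSet_flooded`), so the region beyond the frontier is unbiased given the flooded data
  (`StoppingSetCondExp.lean`).

## References

* O. Schramm, S. Smirnov, Ann. Probab. 39 (2011) 1768–1814, arXiv:1101.5820, proof of Lemma 6.1
  (the lowest crossing and the unbiased region above it); §4, (4.5). [SchrammSmirnov2011]
* B. Bollobás, O. Riordan, *Percolation*, CUP (2006), Ch. 7, proof of Lemma 6, p. 175; Ch. 3,
  Lemma 4 (lowest crossings). [BollobasRiordan2006]
* G. Grimmett, *Percolation*, 2nd ed. (1999), Lemma 11.73 (lowest crossing). [GrimmettPercolation1999]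

Tree: `Seeded.Seeds`, `Seeded.DReach` and its calculus, `Seeded.termTime`, `openSupp`,
`Explorer` framework (`SeededExplorer.lean`, `BoundaryExplorer.lean`, `SequentialProbing.lean`);
`IsFaceOf`, `SeparatesFaces`, `exists_dualEdge_eq_of_isFaceOf`, `isFaceOf_iff_of_dualEdge_eq`,
`isFaceOf_left/right_of_dualEdge_eq` (`LatticeFaceParity.lean`); `IsStoppingSet` (`ColourSwitching.lean`).
-/

noncomputable section

namespace Literature.Probability.Percolation

open LatticeModels Relation ProbeHistory
open scoped Classical

namespace Seeded

variable (𝔖 : Seeds)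

/-! ### One-sided eligibility -/

/-- **Flood-eligible edges**: unexamined examinable edges with a face in `𝒟` (no condition on
the endpoints: the dual is flooded through closed edges and stopped by open ones).
[cite: BollobasRiordan2006, Ch. 7 p. 175 (conditioning on the lowest crossing)] -/
def FloodEligible (X : Finset (Sym2 (Site 2))) (ω : BondConfig (Site 2)) (e : Sym2 (Site 2)) : Prop :=
  e ∈ 𝔖.A ∧ e ∉ X ∧ ∃ f : Site 2, IsFaceOf f e ∧ DReach 𝔖 X ω f

variable {𝔖}

/-- Flood-eligibility only reads `ω` on `X`. [folklore] -/
theorem floodEligible_congr {X : Finset (Sym2 (Site 2))} {ω ω' : BondConfig (Site 2)}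
    (h : ∀ e ∈ X, (e ∈ ω ↔ e ∈ ω')) (e : Sym2 (Site 2)) :
    FloodEligible 𝔖 X ω e ↔ FloodEligible 𝔖 X ω' e := by
  unfold FloodEligible
  simp only [dReach_congr h]

/-! ### The explorer -/

variable (𝔖)

/-- **The dual flooding explorer**: probe some flood-eligible edge if there is one, else stop. [cite: BollobasRiordan2006, Ch. 7 p. 175 (conditioning on the lowest crossing)] -/
def flood : Explorer (Site 2) where
  next h :=
    if hex : ∃ e, FloodEligible 𝔖 (supp h) (↑(openSupp h) : Set (Sym2 (Site 2))) e then some {hex.choose}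
    else none

variable {𝔖}

/-- What a probe of the explorer is: a single eligible edge. [folklore] -/
theorem flood_next_eq_some {h : ProbeHistory (Site 2)} {D : Finset (Sym2 (Site 2))}
    (hD : (flood 𝔖).next h = some D) :
    ∃ e, D = {e} ∧ FloodEligible 𝔖 (supp h) (↑(openSupp h) : Set (Sym2 (Site 2))) e := by
  unfold flood at hD
  simp only at hD
  split_ifs at hD with hex
  rw [Option.some.injEq] at hD
  exact ⟨hex.choose, hD.symm, hex.choose_spec⟩

/-- The explorer stops exactly when no edge is eligible. [folklore] -/
theorem flood_next_eq_none_iff {h : ProbeHistory (Site 2)} :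
    (flood 𝔖).next h = none ↔
      ∀ e, ¬ FloodEligible 𝔖 (supp h) (↑(openSupp h) : Set (Sym2 (Site 2))) e := by
  unfold flood
  simp only
  by_cases hex : ∃ e, FloodEligible 𝔖 (supp h) (↑(openSupp h) : Set (Sym2 (Site 2))) e
  · rw [dif_pos hex]
    refine ⟨fun h0 => ?_, fun h0 => (h0 _ hex.choose_spec).elim⟩
    cases h0
  · rw [dif_neg hex]
    exact ⟨fun _ e he => hex ⟨e, he⟩, fun _ => rfl⟩

variable (𝔖) in
/-- **No edge is probed twice**: eligible edges are unexamined. [cite: BollobasRiordan2006, Ch. 7 p. 175 (each edge is examined at most once)] -/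
theorem flood_fresh : (flood 𝔖).Fresh ∅ := by
  intro h D hD
  obtain ⟨e, rfl, he⟩ := flood_next_eq_some hD
  refine ⟨Finset.disjoint_coe.2 (Finset.disjoint_empty_right _) |>.mono_right (by simp), ?_⟩
  rw [Finset.disjoint_singleton_left]
  exact he.2.1

/-! ### The run on a configuration -/

section Run

variable (𝔖) (ω : BondConfig (Site 2))

/-- **Truthfulness of the records**: the recorded open edges after `t` steps are the examined
edges that are open in `ω`. [folklore] -/
theorem flood_mem_openSupp_hist_iff' (t : ℕ) (e : Sym2 (Site 2)) :
    e ∈ openSupp ((flood 𝔖).hist t ω) ↔ e ∈ supp ((flood 𝔖).hist t ω) ∧ e ∈ ω := by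
  induction t with
  | zero => simp
  | succ t ih =>
    rw [Explorer.hist_succ]
    cases hD : (flood 𝔖).next ((flood 𝔖).hist t ω) with
    | none => rw [Explorer.step_of_none _ hD, openSupp_cons_none, supp_cons_none, ih]
    | some D =>
      rw [Explorer.step_of_some _ hD, mem_openSupp_cons_some_iff, mem_supp_cons_some_iff, ih, mem_obs_iff]
      tauto

/-- The explored clusters computed from the records are those computed from `ω`. [folklore] -/
theorem flood_mem_openSupp_hist_iff (t : ℕ) {e : Sym2 (Site 2)} (he : e ∈ supp ((flood 𝔖).hist t ω)) :
    e ∈ (↑(openSupp ((flood 𝔖).hist t ω)) : Set (Sym2 (Site 2))) ↔ e ∈ ω := by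
  rw [Finset.mem_coe, flood_mem_openSupp_hist_iff']
  exact ⟨fun h => h.2, fun h => ⟨he, h⟩⟩

/-- Eligibility with respect to the records is eligibility with respect to `ω`. [folklore] -/
theorem floodEligible_hist_iff (t : ℕ) (e : Sym2 (Site 2)) :
    FloodEligible 𝔖 (supp ((flood 𝔖).hist t ω)) (↑(openSupp ((flood 𝔖).hist t ω))) e ↔
      FloodEligible 𝔖 (supp ((flood 𝔖).hist t ω)) ω e :=
  floodEligible_congr (fun _ he' => flood_mem_openSupp_hist_iff 𝔖 ω t he') e

/-- **The probe made at time `t` is a single edge, eligible for `ω`.** [folklore] -/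
theorem flood_exists_eq_singleton_of_next_hist {t : ℕ} {D : Finset (Sym2 (Site 2))}
    (hD : (flood 𝔖).next ((flood 𝔖).hist t ω) = some D) :
    ∃ e, D = {e} ∧ FloodEligible 𝔖 (supp ((flood 𝔖).hist t ω)) ω e := by
  obtain ⟨e, rfl, he⟩ := flood_next_eq_some hD
  exact ⟨e, rfl, (floodEligible_hist_iff 𝔖 ω t e).1 he⟩

/-- **Only examinable edges are examined.** [folklore] -/
theorem flood_supp_hist_subset (t : ℕ) : supp ((flood 𝔖).hist t ω) ⊆ 𝔖.A := by
  induction t with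
  | zero => simp
  | succ t ih =>
    cases hD : (flood 𝔖).next ((flood 𝔖).hist t ω) with
    | none => rw [Explorer.supp_hist_succ_of_none _ hD]; exact ih
    | some D =>
      obtain ⟨e, rfl, he⟩ := flood_exists_eq_singleton_of_next_hist 𝔖 ω hD
      intro x hx
      rw [Explorer.mem_supp_hist_succ_iff_of_some _ hD, Finset.mem_singleton] at hx
      rcases hx with rfl | hx
      · exact he.1
      · exact ih hx

/-- **Every examined edge has a face in `𝒟`** (it was eligible when probed). [folklore] -/
theorem dReach_of_mem_supp_hist_flood (t : ℕ) {e : Sym2 (Site 2)}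
    (he : e ∈ supp ((flood 𝔖).hist t ω)) :
    ∃ f : Site 2, IsFaceOf f e ∧ DReach 𝔖 (supp ((flood 𝔖).hist t ω)) ω f := by
  induction t with
  | zero => simp at he
  | succ t ih =>
    have hmono : supp ((flood 𝔖).hist t ω) ⊆ supp ((flood 𝔖).hist (t + 1) ω) :=
      Explorer.supp_hist_mono _ (Nat.le_succ t) ω
    have hold : e ∈ supp ((flood 𝔖).hist t ω) →
        ∃ f : Site 2, IsFaceOf f e ∧ DReach 𝔖 (supp ((flood 𝔖).hist (t + 1) ω)) ω f := by
      intro he'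
      obtain ⟨f, hf, hDr⟩ := ih he'
      exact ⟨f, hf, hDr.mono hmono⟩
    cases hD : (flood 𝔖).next ((flood 𝔖).hist t ω) with
    | none =>
      rw [Explorer.supp_hist_succ_of_none _ hD] at he
      exact hold he
    | some D =>
      rw [Explorer.mem_supp_hist_succ_iff_of_some _ hD] at he
      rcases he with he | he
      · obtain ⟨e₀, he₀, he'⟩ := flood_exists_eq_singleton_of_next_hist 𝔖 ω hD
        rw [he₀, Finset.mem_singleton] at he
        subst he
        obtain ⟨-, -, ⟨f, hf, hDr⟩⟩ := he'
        exact ⟨f, hf, hDr.mono hmono⟩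
      · exact hold he

/-! ### Termination -/

/-- Once the explorer stops it stays stopped. [folklore] -/
theorem flood_next_hist_succ_eq_none {t : ℕ}
    (h : (flood 𝔖).next ((flood 𝔖).hist t ω) = none) :
    (flood 𝔖).next ((flood 𝔖).hist (t + 1) ω) = none := by
  have hs : supp ((flood 𝔖).hist (t + 1) ω) = supp ((flood 𝔖).hist t ω) :=
    Explorer.supp_hist_succ_of_none _ h
  have ho : openSupp ((flood 𝔖).hist (t + 1) ω) = openSupp ((flood 𝔖).hist t ω) := by
    rw [Explorer.hist_succ, Explorer.step_of_none _ h, openSupp_cons_none]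
  rw [flood_next_eq_none_iff, hs, ho]
  exact flood_next_eq_none_iff.1 h

/-- Once stopped, stopped at all later times. [folklore] -/
theorem flood_next_hist_eq_none_of_le {t t' : ℕ} (htt' : t ≤ t')
    (h : (flood 𝔖).next ((flood 𝔖).hist t ω) = none) :
    (flood 𝔖).next ((flood 𝔖).hist t' ω) = none := by
  induction htt' with
  | refl => exact h
  | step _ ih => exact flood_next_hist_succ_eq_none 𝔖 ω ih

/-- While the explorer has not stopped, the number of examined edges is at least the time.
[folklore] -/
theorem flood_le_card_supp_hist {t : ℕ} (h : (flood 𝔖).next ((flood 𝔖).hist t ω) ≠ none) :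
    t ≤ (supp ((flood 𝔖).hist t ω)).card := by
  induction t with
  | zero => exact Nat.zero_le _
  | succ t ih =>
    have ht : (flood 𝔖).next ((flood 𝔖).hist t ω) ≠ none := fun h0 =>
      h (flood_next_hist_succ_eq_none 𝔖 ω h0)
    obtain ⟨D, hD⟩ := Option.ne_none_iff_exists'.1 ht
    obtain ⟨e, rfl, he⟩ := flood_exists_eq_singleton_of_next_hist 𝔖 ω hD
    rw [Explorer.card_supp_hist_succ_of_some _ hD (Finset.disjoint_singleton_left.2 he.2.1),
      Finset.card_singleton]
    have := ih ht
    omega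


/-- **Termination**: at time `termTime 𝔖` the explorer has stopped. [cite: BollobasRiordan2006, Ch. 7 p. 175 (the exploration ends)] -/
theorem flood_next_hist_termTime : (flood 𝔖).next ((flood 𝔖).hist (termTime 𝔖) ω) = none := by
  by_contra h
  have h1 := flood_le_card_supp_hist 𝔖 ω h
  have h2 : (supp ((flood 𝔖).hist (termTime 𝔖) ω)).card ≤ 𝔖.A.card :=
    Finset.card_le_card (flood_supp_hist_subset 𝔖 ω _)
  unfold termTime at h1 h2
  omega

/-- **At termination no edge is eligible** (for the configuration `ω` itself). [folklore] -/
theorem not_floodEligible_termTime (e : Sym2 (Site 2)) :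
    ¬ FloodEligible 𝔖 (supp ((flood 𝔖).hist (termTime 𝔖) ω)) ω e := by
  have h := flood_next_eq_none_iff.1 (flood_next_hist_termTime 𝔖 ω) e
  rwa [floodEligible_hist_iff] at h

end Run


/-! ### The flooded set: a stopping set with values in `A` -/

variable (𝔖)

/-- **The flooded (examined) edges of `ω`**: the support of the history of the flood at
termination ("the configuration inside `M̄`"). [cite: SchrammSmirnov2011, proof of Lemma 6.1 (the region M below the lowest crossing)] -/
def flooded (ω : BondConfig (Site 2)) : Finset (Sym2 (Site 2)) :=
  supp ((flood 𝔖).hist (termTime 𝔖) ω)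

variable {𝔖}

/-- Flooded edges are examinable. [folklore] -/
theorem flooded_subset (ω : BondConfig (Site 2)) : flooded 𝔖 ω ⊆ 𝔖.A :=
  flood_supp_hist_subset 𝔖 ω _

/-- **The flooded set is a stopping set** ("`γ` depends only on the configuration inside `M̄`";
no look-ahead). [cite: SchrammSmirnov2011, proof of Lemma 6.1 ("the lowest crossing γ depends only on the configuration inside M̄")] -/
theorem isStoppingSet_flooded : IsStoppingSet (flooded 𝔖) := by
  intro ω ω' hag
  unfold flooded at hag ⊢
  rw [(flood 𝔖).hist_eq_of_agree hag rfl]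

/-! ### Terminal data of the flood and its consequences -/

variable (𝔖)

/-- **Terminal data of the flood** `(X, ω)`: examined edges are examinable, every examined edge
has a face in `𝒟`, and no edge is flood-eligible. [folklore] -/
structure IsFloodTerminal (X : Finset (Sym2 (Site 2))) (ω : BondConfig (Site 2)) : Prop where
  subset : X ⊆ 𝔖.A
  one_arm : ∀ e ∈ X, ∃ f : Site 2, IsFaceOf f e ∧ DReach 𝔖 X ω f
  not_eligible : ∀ e, ¬ FloodEligible 𝔖 X ω e

variable {𝔖}

/-- **The flooded set of `ω` is terminal data for `ω`.** [folklore] -/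
theorem isFloodTerminal_flooded (ω : BondConfig (Site 2)) : IsFloodTerminal 𝔖 (flooded 𝔖 ω) ω :=
  ⟨flooded_subset ω, fun _ he => dReach_of_mem_supp_hist_flood 𝔖 ω _ he,
    not_floodEligible_termTime 𝔖 ω⟩

section Terminal

variable {X : Finset (Sym2 (Site 2))} {ω : BondConfig (Site 2)} (hT : IsFloodTerminal 𝔖 X ω)
include hT

/-- **Examined closed edges have both faces in `𝒟`.** [folklore] -/
theorem IsFloodTerminal.dReach_of_mem {e : Sym2 (Site 2)} (heX : e ∈ X) (heω : e ∉ ω) {f : Site 2}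
    (hf : IsFaceOf f e) : DReach 𝔖 X ω f := by
  obtain ⟨f₀, hf₀, hD⟩ := hT.one_arm e heX
  have he := 𝔖.A_subset e (hT.subset heX)
  obtain ⟨g, -, hd⟩ := exists_dualEdge_eq_of_isFaceOf he hf₀
  rcases (isFaceOf_iff_of_dualEdge_eq hd).1 hf with rfl | rfl
  · exact hD
  · exact hD.step heX heω he hd

/-- **The flood misses nothing**: an examinable edge with a face in `𝒟` is examined.
[cite: BollobasRiordan2006, Ch. 7 p. 175 (every edge adjacent to the explored region is examined)] -/
theorem IsFloodTerminal.mem_of_dReach {e : Sym2 (Site 2)} (he : e ∈ 𝔖.A) {f : Site 2} (hf : IsFaceOf f e)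
    (hD : DReach 𝔖 X ω f) : e ∈ X := by
  by_contra heX
  exact hT.not_eligible e ⟨he, heX, f, hf, hD⟩

/-- **The frontier of the flood is open and examined**: an examinable edge separating a face of
`𝒟` from a face not in `𝒟` is examined and open — the lattice form of "the lowest crossing".
[cite: SchrammSmirnov2011, proof of Lemma 6.1 ("let γ be the lowest ω-crossing")] -/
theorem IsFloodTerminal.mem_and_mem_of_isFrontier {e : Sym2 (Site 2)} (he : e ∈ 𝔖.A)
    (hfr : SeparatesFaces {f | DReach 𝔖 X ω f} e) : e ∈ X ∧ e ∈ ω := by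
  obtain ⟨a, b, hd, ha, hb⟩ := hfr
  have heX : e ∈ X := hT.mem_of_dReach he (isFaceOf_left_of_dualEdge_eq hd) ha
  refine ⟨heX, ?_⟩
  by_contra heω
  exact hb (hT.dReach_of_mem heX heω (isFaceOf_right_of_dualEdge_eq hd))

/-- **`𝒟` is the whole dual cluster of the seeds**: every face joined to a seed face across closed
EXAMINABLE edges is in `𝒟` (each such edge has, inductively, a face in `𝒟`, hence is examined).
[cite: BollobasRiordan2006, Ch. 3 Lemma 4 / Ch. 7 p. 175 (the region below the lowest crossing)] -/
theorem IsFloodTerminal.dReach_of_reflTransGen {g f : Site 2} (hg : g ∈ 𝔖.D₀)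
    (h : ReflTransGen (fun a b => ∃ e ∈ 𝔖.A, e ∉ ω ∧ dualEdge e = s(a, b)) g f) :
    DReach 𝔖 X ω f := by
  induction h with
  | refl => exact dReach_of_mem_seeds X ω hg
  | @tail a b _ hab ih =>
    obtain ⟨e, heA, heω, hd⟩ := hab
    have heX : e ∈ X := hT.mem_of_dReach heA (isFaceOf_left_of_dualEdge_eq hd) ih
    exact ih.step heX heω (𝔖.A_subset e heA) hd

/-- Conversely `𝒟` is contained in that dual cluster (examined edges are examinable). [folklore] -/
theorem IsFloodTerminal.reflTransGen_of_dReach {f : Site 2} (hf : DReach 𝔖 X ω f) :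
    ∃ g ∈ 𝔖.D₀, ReflTransGen (fun a b => ∃ e ∈ 𝔖.A, e ∉ ω ∧ dualEdge e = s(a, b)) g f := by
  obtain ⟨g, hg, h⟩ := hf
  exact ⟨g, hg, reflTransGen_of_imp (fun a b ⟨e, heX, heω, _, hd⟩ => ⟨e, hT.subset heX, heω, hd⟩) h⟩

/-- **Examined open edges border `𝒟`**: every examined edge has a face in `𝒟`; if it is open,
it is a frontier edge as soon as its other face is not in `𝒟`. (Bookkeeping form.) [folklore] -/
theorem IsFloodTerminal.exists_isFaceOf_dReach {e : Sym2 (Site 2)} (heX : e ∈ X) :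
    ∃ f : Site 2, IsFaceOf f e ∧ DReach 𝔖 X ω f :=
  hT.one_arm e heX

end Terminal

end Seeded

end Literature.Probability.Percolation
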